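import Mathlib
import Literature.Probability.LatticeModels.LoopO1
import Literature.Probability.LatticeModels.RandomCurrents
import Literature.Probability.LatticeModels.IsingThermodynamics
import Literature.Probability.LatticeModels.ThermodynamicLimit

/-!
# Crux StrandShadow (stmt-CriticalPhenomena-14626) — ideator 1, round 1: first lemmas (statements only)

Two crux-idea cards (`Ideas/loop-footprint-strand-mass.md`, `Ideas/odd-cluster-cut-exact-helper.md`).
Every `def … : Prop` below is a STATEMENT; nothing is proved here. Vocabulary: the tree's sourced
loop-O(1) objects (`tJoins`, `loopO1PartitionFunction`, LoopO1.lean), random currents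
(`Current`, `currentSum`, RandomCurrents.lean), the critical correlators `criticalCorr 3 n`.
-/

namespace Summit.CriticalPhenomena.Ising3DConformalLimit.Cruxes.StrandShadow.Ideator1

open scoped BigOperators symmDiff Classical
open Finset Literature.Probability.LatticeModels

/-! ## Card 1 — loop footprint: the sourced loop measure's one-edge law and the strand-mass floor -/

/-- (L1, provable now, S) ONE-EDGE LAW of the sourced loop-O(1) measure: removing the edge `e = uv`
from a `T`-join of `S` containing it gives a `T`-join of `S ∆ {u,v}` in `G − e`, bijectively, so
`∑_{F ∈ 𝒯_G(S), e ∈ F} t^{|F|} = t · Z^{S ∆ {u,v}}_t(G − e)`; hence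
`ℓ^S_{G,t}[e ∈ F] = t R_S /(1 + t R_S)` with `R_S = Z^{S∆uv}(G−e)/Z^S(G−e)`. -/
def LoopEdgeLaw : Prop :=
  ∀ (V : Type) [Fintype V] [DecidableEq V] (G : SimpleGraph V) [DecidableRel G.Adj] (t : ℝ)
    (S : Finset V) (u v : V), G.Adj u v →
    (∑ F ∈ (tJoins G Set.univ S).filter (fun F : Finset (Sym2 V) => s(u, v) ∈ F), t ^ F.card)
      = t * loopO1PartitionFunction (G.deleteEdges {s(u, v)}) t (S ∆ ({u} ∆ {v}))

/-- (L2, provable now, S) THE SOURCE-INDUCED EXCESS IS A THERMAL RESPONSE (pure loop combinatorics):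
with `A_S(e) := ∑_{F ∈ 𝒯_G(S), e ∈ F} t^{|F|}` and `G' := G − e`, `e = uv`,
`Z^∅(G)·A_{xy}(e) − Z^{xy}(G)·A_∅(e) = t·(Z^∅(G') Z^{xy∆uv}(G') − Z^{xy}(G') Z^{uv}(G'))`,
whose right side is `t (Z^∅(G'))² ⟨σ_xσ_y ; σ_uσ_v⟩^{free}_{G', β}` (`t = tanh β`, HT expansion
`isingCorr_free_eq_hteSum_div`) and is `≥ 0` by GKS II. So
`ℓ^{xy}[e ∈ F] − ℓ^{∅}[e ∈ F] = t⟨σ_xσ_y;σ_uσ_v⟩_{G'} / ((1 + tR_{xy})(1 + tR_∅)⟨σ_xσ_y⟩_{G'}) ≥ 0`. -/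
def ExcessIsThermalResponse : Prop :=
  ∀ (V : Type) [Fintype V] [DecidableEq V] (G : SimpleGraph V) [DecidableRel G.Adj] (t : ℝ)
    (x y u v : V), G.Adj u v →
    loopO1PartitionFunction G t ∅ *
        (∑ F ∈ (tJoins G Set.univ ({x} ∆ {y})).filter (fun F : Finset (Sym2 V) => s(u, v) ∈ F), t ^ F.card)
      - loopO1PartitionFunction G t ({x} ∆ {y}) *
        (∑ F ∈ (tJoins G Set.univ ∅).filter (fun F : Finset (Sym2 V) => s(u, v) ∈ F), t ^ F.card)
      = t * (loopO1PartitionFunction (G.deleteEdges {s(u, v)}) t ∅ *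
              loopO1PartitionFunction (G.deleteEdges {s(u, v)}) t (({x} ∆ {y}) ∆ ({u} ∆ {v}))
            - loopO1PartitionFunction (G.deleteEdges {s(u, v)}) t ({x} ∆ {y}) *
              loopO1PartitionFunction (G.deleteEdges {s(u, v)}) t ({u} ∆ {v}))

/-- (L3, provable now, M) FOOTPRINT FLOOR: the source cluster `K_x(F)` of `F ~ ℓ^{xy}_G` carries the
whole excess edge mass. For every edge set `B`,
`E^{xy}|E(K_x(F)) ∩ B| ≥ ∑_{e ∈ B} (ℓ^{xy}[e ∈ F] − ℓ^{∅}[e ∈ F])`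
(decompose `F = K ⊔ L`, `L ~ ℓ^∅` on `G − V(K)` given `K`; the loop density of `ℓ^∅_{G−V(K)}` is
edgewise `≤` that of `ℓ^∅_G` by L1 + Griffiths monotonicity in the domain). Cleared denominators: -/
def FootprintFloor : Prop :=
  ∀ (V : Type) [Fintype V] [DecidableEq V] (G : SimpleGraph V) [DecidableRel G.Adj] (t : ℝ),
    0 ≤ t → t < 1 → ∀ (x y : V) (B : Finset (Sym2 V)), x ≠ y →
    (∑ e ∈ B,
        (loopO1PartitionFunction G t ∅ *
            (∑ F ∈ (tJoins G Set.univ ({x} ∆ {y})).filter (fun F : Finset (Sym2 V) => e ∈ F), t ^ F.card)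
          - loopO1PartitionFunction G t ({x} ∆ {y}) *
            (∑ F ∈ (tJoins G Set.univ ∅).filter (fun F : Finset (Sym2 V) => e ∈ F), t ^ F.card)))
      ≤ loopO1PartitionFunction G t ∅ *
          ∑ F ∈ tJoins G Set.univ ({x} ∆ {y}),
            t ^ F.card *
              ((B.filter (fun e : Sym2 V => e ∈ F ∧
                  ∀ w ∈ e, (SimpleGraph.fromEdgeSet (↑F : Set (Sym2 V))).Reachable x w)).card : ℝ)

/-- (L4, OPEN INPUT of card 1 — "local thermal floor", a `ν < 2/3` / `α > 0`-type statement, margin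
`y_t − 3/2 = 0.087` on the numerics) the `β`-response of `log ⟨σ_{a₀}σ_{a₁}⟩_{β_c}` collected over the
bonds of the central box `[−l,l]³` of the tetrahedron `A_l` exceeds `l^{3/2+δ}`:
`∑_{e ⊂ [−l,l]³} ⟨σ_{a₀}σ_{a₁} ; ε_e⟩_{β_c} ≥ c · l^{3/2+δ} · ⟨σ_{a₀}σ_{a₁}⟩_{β_c}`.
With L2–L3 it gives the STRAND MASS floor `E_{ℓ^{a₀a₁}}|E(K) ∩ [−l,l]³| ≳ l^{3/2+δ}` (StrandMass of the
route's two-layer plan), the first-moment input of every second-moment attack on the crux. -/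
def LocalThermalFloor : Prop :=
  let tetra : Fin 4 → Site 3 := ![![-1, -1, -1], ![1, 1, -1], ![1, -1, 1], ![-1, 1, 1]]
  ∃ c δ : ℝ, 0 < c ∧ 0 < δ ∧ ∀ l : ℕ, 1 ≤ l →
    c * (l : ℝ) ^ ((3 : ℝ) / 2 + δ) * criticalCorr 3 2 ![(l : ℤ) • tetra 0, (l : ℤ) • tetra 1]
      ≤ ∑ u ∈ box 3 l, ∑ i : Fin 3,
          (criticalCorr 3 4 ![(l : ℤ) • tetra 0, (l : ℤ) • tetra 1, u, u + Pi.single i 1]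
            - criticalCorr 3 2 ![(l : ℤ) • tetra 0, (l : ℤ) • tetra 1] *
              criticalCorr 3 2 ![u, u + Pi.single i 1])

/-! ## Card 2 — condition on BOTH odd clusters: the helper medium is an exact nested sourceless
double current -/

/-- (L5, provable in print — Aizenman–Duminil-Copin–Sidoravicius 2015, Lemma 2.2, sourceless case;
M) NESTED SOURCELESS SWITCHING / PRODUCT FORMULA: for a subgraph `H ≤ G` on the same vertex set,
a sourceless current `n_H` on `H` and an independent sourceless current `n_G` on `G`, the
probability that `u` and `v` are connected INSIDE `H` by the traced edges of `n_H + n_G|_H` is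
`⟨σ_uσ_v⟩^{free}_H · ⟨σ_uσ_v⟩^{free}_G` — in current sums:
`∑_{∂n_H = ∅, ∂n_G = ∅} w w 1[u ↔_H v] = Z^{uv}_H · Z^{uv}_G`. (The medium left after deleting the
two odd clusters `K, K'` of `F ~ ℓ^A` is exactly such a pair: `H = Λ − V(K ∪ K')`.) -/
def NestedSourcelessSwitching : Prop :=
  ∀ (V : Type) [Fintype V] [DecidableEq V] (G H : SimpleGraph V) [DecidableRel G.Adj]
    [DecidableRel H.Adj], H ≤ G → ∀ β : ℝ, 0 ≤ β → ∀ u v : V,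
    (∑' p : Current H × Current G,
        (if p.1.sources = ∅ ∧ p.2.sources = ∅ then p.1.weight β * p.2.weight β else 0) *
          (if (SimpleGraph.fromEdgeSet (p.1.traced ∪ (p.2.traced ∩ H.edgeSet))).Reachable u v
            then (1 : ℝ) else 0))
      = currentSum H β ({u} ∆ {v}) * currentSum G β ({u} ∆ {v})

/-- (L6, provable now given L5, S) EXACT FIRST MOMENT OF HELPER BRIDGES between two deterministic
disjoint vertex sets `W, W'` (the odd clusters): with `H = G[V ∖ (W ∪ W')]` (vertices of `W ∪ W'`
isolated), the expected number of pairs `(u, v) ∈ ∂W × ∂W'` (`H`-vertices adjacent to `W`, resp.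
`W'`) joined inside `H` by the helper medium is `∑_{u,v} ⟨σ_uσ_v⟩_H ⟨σ_uσ_v⟩_G`; stated as the
current-sum identity summed over the boundary pairs. -/
def HelperBridgeFirstMoment : Prop :=
  ∀ (V : Type) [Fintype V] [DecidableEq V] (G : SimpleGraph V) [DecidableRel G.Adj]
    (W W' : Finset V) (β : ℝ), 0 ≤ β → Disjoint W W' →
    let H : SimpleGraph V := G.induce ((↑(W ∪ W') : Set V)ᶜ) |>.spanningCoe
    let bdW : Finset V := univ.filter (fun u => u ∉ W ∪ W' ∧ ∃ w ∈ W, G.Adj u w)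
    let bdW' : Finset V := univ.filter (fun v => v ∉ W ∪ W' ∧ ∃ w ∈ W', G.Adj v w)
    (∑' p : Current H × Current G,
        (if p.1.sources = ∅ ∧ p.2.sources = ∅ then p.1.weight β * p.2.weight β else 0) *
          ∑ u ∈ bdW, ∑ v ∈ bdW',
            (if (SimpleGraph.fromEdgeSet (p.1.traced ∪ (p.2.traced ∩ H.edgeSet))).Reachable u v
              then (1 : ℝ) else 0))
      = ∑ u ∈ bdW, ∑ v ∈ bdW', currentSum H β ({u} ∆ {v}) * currentSum G β ({u} ∆ {v})

end Summit.CriticalPhenomena.Ising3DConformalLimit.Cruxes.StrandShadow.Ideator1
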